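import Literature.Probability.Percolation.ConditionalPositiveAssociationProofs
import Summits.CriticalPhenomena.PercolationContinuityZ3.Theorems.PercNearOneGluingNoHeavyConstsLinearLowerTailConjecture
import Mathlib.Combinatorics.SetFamily.FourFunctions
import HarnessLib

/-!
# Two crossing two-cluster splits cost a four-way shattering: an Ahlswede–Daykin inequality for bond percolation

builds on p205010 (kernel theorem, internal audit signed; external expert review pending)

PAPER-2 track "percolation constants", part (ii), seat `prim-consts-1`, gen 6 (lane index `run/shared/lean/prim/consts/CONSTANTS.md`
§4 N30; memo `FROM-prim-consts-1-g6-TROPICAL-AND-FOUR-POINT.md` §3).  Support file for the crux `NoHeavyLowerTail`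
(stmt-CriticalPhenomena-4575; `--supports … --as helper`): theorems only, standard axioms.

Context.  The "second barrier" of the three-halves programme (memo g4 §6, CONSTANTS §4 N22) says that the iid-coin splitting law passes
every partition-level association inequality (Harris; vdBHK Thms 1.3–1.5).  This file records, in the kernel, a partition-level
inequality that the iid-coin law VIOLATES — albeit only at second order (an `O(s²)` perturbation of that law repairs it), so it does not
break the barrier; the genuinely first-order candidate is the conjectured four-point splitting inequality `Consts.FourPointSplit`
(sibling file `…ConstsFourPointSplit`).

* `Consts.real_mul_real_le_of_lattice` — event form of the Ahlswede–Daykin four functions theorem for `prodBernoulli`: if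
  `ω ∩ ω' ∈ C` and `ω ∪ ω' ∈ D` whenever `ω ∈ A`, `ω' ∈ B`, then `μ(A) μ(B) ≤ μ(C) μ(D)`.
* `Consts.real_split_mul_split_le` — for four vertices `a b c d`:
  `μ(a↔b, c↔d, a↮c) · μ(a↔c, b↔d, a↮b) ≤ μ(a,b,c,d pairwise separated) · μ(a,b,c,d all connected)`:
  the edgewise minimum of a configuration split as `ab|cd` and one split as `ac|bd` has the four points pairwise separated, the edgewise
  maximum has them all connected.  (The iid-coin law has both factors on the left of order `s` and the first factor on the right `= 0`.)

References: R. Ahlswede, D. E. Daykin, Z. Wahrsch. Verw. Gebiete 43 (1978) 183–185 (Mathlib `four_functions_theorem_univ`);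
J. van den Berg, O. Häggström, J. Kahn, Random Structures Algorithms 29 (2006) 417–435; G. Grimmett, *Percolation* (1999), §2.2.
-/

noncomputable section

namespace Summit.CriticalPhenomena.PercolationContinuityZ3.Theorems

open MeasureTheory Set Literature.Probability.LatticeModels Literature.Probability.Percolation
open Literature.Probability.Percolation.BHK2006 (weight weight_nonneg weight_inter_mul_union integral_prodBernoulli_eq_sum)
open scoped Classical

namespace Consts

variable {ι : Type*} [Fintype ι]

/-- A `prodBernoulli` probability as the weighted finite sum of an indicator. [folklore] -/
theorem real_eq_sum_weight_indicator (w : ι → unitInterval) (A : Set (Set ι)) :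
    (prodBernoulli w).real A = ∑ ω : Set ι, weight (fun e => (w e : ℝ)) ω * A.indicator 1 ω := by
  rw [← integral_indicator_one (MeasurableSet.of_discrete (s := A)), integral_prodBernoulli_eq_sum]

/-- **Event form of the four functions theorem for product measures.**  If for all `ω ∈ A` and `ω' ∈ B` the edgewise minimum
`ω ∩ ω'` lies in `C` and the edgewise maximum `ω ∪ ω'` lies in `D`, then `μ(A)·μ(B) ≤ μ(C)·μ(D)` for `μ = prodBernoulli w`.
[cite: AhlswedeDaykin1978, Theorem 1] -/
theorem real_mul_real_le_of_lattice (w : ι → unitInterval) {A B C D : Set (Set ι)}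
    (h : ∀ ω ∈ A, ∀ ω' ∈ B, ω ∩ ω' ∈ C ∧ ω ∪ ω' ∈ D) :
    (prodBernoulli w).real A * (prodBernoulli w).real B ≤ (prodBernoulli w).real C * (prodBernoulli w).real D := by
  simp only [real_eq_sum_weight_indicator]
  set w' : ι → ℝ := fun e => (w e : ℝ) with hw'
  have hw0 : ∀ e, 0 ≤ w' e := fun e => (w e).2.1
  have hw1 : ∀ e, w' e ≤ 1 := fun e => (w e).2.2
  have hind : ∀ (X : Set (Set ι)) (ω : Set ι), 0 ≤ X.indicator (1 : Set ι → ℝ) ω := fun X ω =>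
    Set.indicator_nonneg (fun _ _ => zero_le_one) ω
  refine four_functions_theorem_univ (fun ω => weight w' ω * A.indicator 1 ω) (fun ω => weight w' ω * B.indicator 1 ω)
    (fun ω => weight w' ω * C.indicator 1 ω) (fun ω => weight w' ω * D.indicator 1 ω)
    (fun ω => mul_nonneg (weight_nonneg hw0 hw1 ω) (hind A ω)) (fun ω => mul_nonneg (weight_nonneg hw0 hw1 ω) (hind B ω))
    (fun ω => mul_nonneg (weight_nonneg hw0 hw1 ω) (hind C ω)) (fun ω => mul_nonneg (weight_nonneg hw0 hw1 ω) (hind D ω))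
    fun ω ω' => ?_
  change weight w' ω * A.indicator 1 ω * (weight w' ω' * B.indicator 1 ω') ≤
    weight w' (ω ∩ ω') * C.indicator 1 (ω ∩ ω') * (weight w' (ω ∪ ω') * D.indicator 1 (ω ∪ ω'))
  by_cases hA : ω ∈ A
  · by_cases hB : ω' ∈ B
    · obtain ⟨hC, hD⟩ := h ω hA ω' hB
      rw [Set.indicator_of_mem hA, Set.indicator_of_mem hB, Set.indicator_of_mem hC, Set.indicator_of_mem hD]
      simp only [Pi.one_apply, mul_one]
      rw [weight_inter_mul_union]
    · rw [Set.indicator_of_notMem hB]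
      simp only [mul_zero]
      exact mul_nonneg (mul_nonneg (weight_nonneg hw0 hw1 _) (hind C _)) (mul_nonneg (weight_nonneg hw0 hw1 _) (hind D _))
  · rw [Set.indicator_of_notMem hA]
    simp only [mul_zero, zero_mul]
    exact mul_nonneg (mul_nonneg (weight_nonneg hw0 hw1 _) (hind C _)) (mul_nonneg (weight_nonneg hw0 hw1 _) (hind D _))

variable {V : Type*} [Fintype V]

omit [Fintype V] in
/-- Open connection is monotone in the configuration. [folklore] -/
theorem openConn_mono {ω ω' : BondConfig V} (hle : ω ⊆ ω') {x y : V} (h : ω ∈ openConn x y) : ω' ∈ openConn x y :=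
  SimpleGraph.Reachable.mono (BHK2006.openGraph_le hle) h

/-- **KERNEL (two crossing splits cost a shattering).**  For four vertices `a b c d` of a finite weighted graph:
`μ(a↔b, c↔d, a↮c) · μ(a↔c, b↔d, a↮b) ≤ μ(a,b,c,d pairwise disconnected) · μ(a,b,c,d pairwise connected)`.
Proof: Ahlswede–Daykin with `ω ∩ ω'` (pairwise separated: each of the six pairs is separated in one of the two splits) and `ω ∪ ω'`
(all connected).  The iid-coin splitting law of the association barrier violates this (left side of order `s²`, right side `0`), but only
at second order. [cite: AhlswedeDaykin1978, Theorem 1] -/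
theorem real_split_mul_split_le (w : Sym2 V → unitInterval) (a b c d : V) :
    (prodBernoulli w).real (openConn a b ∩ openConn c d ∩ (openConn a c)ᶜ) *
        (prodBernoulli w).real (openConn a c ∩ openConn b d ∩ (openConn a b)ᶜ) ≤
      (prodBernoulli w).real ((openConn a b)ᶜ ∩ (openConn a c)ᶜ ∩ (openConn a d)ᶜ ∩ (openConn b c)ᶜ ∩ (openConn b d)ᶜ ∩
          (openConn c d)ᶜ) *
        (prodBernoulli w).real (openConn a b ∩ openConn a c ∩ openConn a d ∩ openConn b c ∩ openConn b d ∩ openConn c d) := by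
  refine real_mul_real_le_of_lattice w fun ω hω ω' hω' => ?_
  simp only [Set.mem_inter_iff, Set.mem_compl_iff] at hω hω' ⊢
  obtain ⟨⟨hab, hcd⟩, hac⟩ := hω
  obtain ⟨⟨hac', hbd'⟩, hab'⟩ := hω'
  -- reachability algebra in `ω`, `ω'`
  have r : ∀ {η : BondConfig V} {x y : V}, η ∈ openConn x y → (openGraph η).Reachable x y := fun h => h
  have m : ∀ {η : BondConfig V} {x y : V}, (openGraph η).Reachable x y → η ∈ openConn x y := fun h => h
  have had : ω ∉ openConn a d := fun h => hac (m ((r h).trans (r hcd).symm))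
  have hbc : ω ∉ openConn b c := fun h => hac (m ((r hab).trans (r h)))
  have hbd : ω ∉ openConn b d := fun h => hac (m (((r hab).trans (r h)).trans (r hcd).symm))
  have hcd' : ω' ∉ openConn c d := fun h => hab' (m (((r hac').trans (r h)).trans (r hbd').symm))
  have dn : ∀ {x y : V}, (ω ∉ openConn x y ∨ ω' ∉ openConn x y) → ω ∩ ω' ∉ openConn x y := by
    intro x y hxy hmem
    rcases hxy with h | h
    · exact h (openConn_mono Set.inter_subset_left hmem)
    · exact h (openConn_mono Set.inter_subset_right hmem)
  have upl : ∀ {x y : V}, ω ∈ openConn x y → ω ∪ ω' ∈ openConn x y := fun h => openConn_mono Set.subset_union_left h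
  have upr : ∀ {x y : V}, ω' ∈ openConn x y → ω ∪ ω' ∈ openConn x y := fun h => openConn_mono Set.subset_union_right h
  refine ⟨⟨⟨⟨⟨⟨dn (Or.inr hab'), dn (Or.inl hac)⟩, dn (Or.inl had)⟩, dn (Or.inl hbc)⟩, dn (Or.inl hbd)⟩, dn (Or.inr hcd')⟩, ?_⟩
  have uab := upl hab
  have uac := upr hac'
  have ubd := upr hbd'
  have ucd := upl hcd
  refine ⟨⟨⟨⟨⟨uab, uac⟩, m ((r uab).trans (r ubd))⟩, m ((r uab).symm.trans (r uac))⟩, ubd⟩, ucd⟩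

end Consts

end Summit.CriticalPhenomena.PercolationContinuityZ3.Theorems
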